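import Mathlib

/-!
# Candidate proof of the registered stub `stub_intPairsHosting` (line `radix-carry-hosting`,
crux `CwPowerHosting.HostingRateThree`, stmt-MatrixMultiplication-15970)

Integer pair systems `(p_i, q_i)` that are zero-sum-free (only the trivial pattern word sums to `0`) with all
pattern sums of absolute value `< M` host `supp(xyz^{⊠N})` freely in `ZMod M`:
`γ z = Σ_i s_i(z_i)`, `s_i = (0, p_i, q_i)`, `β = γ`, `α = γ - Σ_i (p_i + q_i)`.  The 27 coordinate triples map to the ten
coefficient patterns (`pat`; good triples ↦ pattern `0`), so `α x + β y + γ z` is the cast of the integer word sum, which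
is `≡ 0 (mod M)` iff it is `0` (`|·| < M`) iff the word is trivial (zero-sum-freeness) iff every coordinate is good.

The definitions `coeff`, `wordSum`, `IsZeroSumFree`, `TransversalBound`, `IsFreeHosting` are VERBATIM COPIES (namespace `…Theorems.HostingRateThree.RadixCarryHosting`, so the skeleton can import this file without clashes) of those of the
skeleton `Cruxes/HostingRateThree/Lines/radix_carry_hosting.lean`, and `stub_intPairsHosting` below has verbatim the
type `Stmt.stub_intPairsHosting` (unfolded one step).  Strategist planner-cstrat-stmt-MatrixMultiplication-15970-0.
-/

set_option linter.dupNamespace false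

namespace Summit.MatrixMultiplication.MatrixMultiplication.Theorems.HostingRateThree.RadixCarryHosting

open Finset

def coeff : Fin 10 → ℤ × ℤ :=
  ![(0, 0), (1, 0), (-1, 0), (0, 1), (0, -1), (1, -1), (-1, 1), (-1, -1), (2, -1), (-1, 2)]

def wordSum {N : ℕ} (p q : Fin N → ℤ) (w : Fin N → Fin 10) : ℤ :=
  ∑ i, ((coeff (w i)).1 * p i + (coeff (w i)).2 * q i)

def IsZeroSumFree {N : ℕ} (p q : Fin N → ℤ) : Prop :=
  ∀ w : Fin N → Fin 10, wordSum p q w = 0 → ∀ i, w i = 0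

def TransversalBound {N : ℕ} (p q : Fin N → ℤ) (M : ℕ) : Prop :=
  ∀ w : Fin N → Fin 10, |wordSum p q w| < M

def IsFreeHosting {N : ℕ} {H : Type} [AddCommGroup H] (α β γ : (Fin N → Fin 3) → H) : Prop :=
  ∀ x y z : Fin N → Fin 3, α x + β y + γ z = 0 ↔ ∀ i, x i ≠ y i ∧ x i ≠ z i ∧ y i ≠ z i

namespace StubIntPairsHosting

/-- The coefficient pattern of a coordinate triple: with `n₁, n₂` the numbers of `1`s and `2`s among `(a,b,c)`,
`s(a)+s(b)+s(c) - (p+q) = (n₁-1) p + (n₂-1) q`, and `(n₁-1, n₂-1)` is entry `pat a b c` of `coeff`. -/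
def pat : Fin 3 → Fin 3 → Fin 3 → Fin 10 := fun a b c =>
  (![![![7, 4, 2], ![4, 5, 0], ![2, 0, 6]],
     ![![4, 5, 0], ![5, 8, 1], ![0, 1, 3]],
     ![![2, 0, 6], ![0, 1, 3], ![6, 3, 9]]] : Fin 3 → Fin 3 → Fin 3 → Fin 10) a b c

theorem pat_eq_zero_iff (a b c : Fin 3) : pat a b c = 0 ↔ (a ≠ b ∧ a ≠ c ∧ b ≠ c) := by
  revert a b c; decide

/-- The digit map of one coordinate: `s = (0, P, Q)`. -/
def sv (P Q : ℤ) : Fin 3 → ℤ := ![0, P, Q]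

theorem pat_spec (P Q : ℤ) (a b c : Fin 3) :
    sv P Q a + sv P Q b + sv P Q c - (P + Q) = (coeff (pat a b c)).1 * P + (coeff (pat a b c)).2 * Q := by
  fin_cases a <;> fin_cases b <;> fin_cases c <;> simp [sv, pat, coeff] <;> ring

theorem coeff_zero : coeff 0 = (0, 0) := rfl

end StubIntPairsHosting

open StubIntPairsHosting in
/-- **Registered stub `stub_intPairsHosting`** (type = `Stmt.stub_intPairsHosting` of the skeleton, verbatim). -/
theorem stub_intPairsHosting :
    ∀ (N M : ℕ) (p q : Fin N → ℤ), 1 ≤ M → IsZeroSumFree p q → TransversalBound p q M →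
      ∃ α β γ : (Fin N → Fin 3) → ZMod M, IsFreeHosting α β γ := by
  intro N M p q _hM hfree hbound
  -- the additive leg `φ` and the constant `K = Σ (p_i + q_i)`
  let φ : (Fin N → Fin 3) → ℤ := fun x => ∑ i, sv (p i) (q i) (x i)
  let K : ℤ := ∑ i, (p i + q i)
  refine ⟨fun x => ((φ x - K : ℤ) : ZMod M), fun y => ((φ y : ℤ) : ZMod M), fun z => ((φ z : ℤ) : ZMod M), ?_⟩
  intro x y z
  -- the pattern word of `(x, y, z)` and the integer identity
  set w : Fin N → Fin 10 := fun i => pat (x i) (y i) (z i) with hw_def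
  have hT : φ x - K + φ y + φ z = wordSum p q w := by
    have h1 : φ x - K + φ y + φ z = ∑ i, (sv (p i) (q i) (x i) + sv (p i) (q i) (y i) + sv (p i) (q i) (z i)
        - (p i + q i)) := by
      simp only [φ, K, Finset.sum_add_distrib, Finset.sum_sub_distrib]
      ring
    rw [h1]
    unfold wordSum
    refine Finset.sum_congr rfl fun i _ => ?_
    rw [hw_def]
    exact pat_spec (p i) (q i) (x i) (y i) (z i)
  have hcast : ((↑(φ x - K) : ZMod M) + (↑(φ y) : ZMod M) + (↑(φ z) : ZMod M))
      = ((φ x - K + φ y + φ z : ℤ) : ZMod M) := by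
    push_cast; ring
  constructor
  · intro h0
    rw [hcast, hT, ZMod.intCast_zmod_eq_zero_iff_dvd] at h0
    have hzero : wordSum p q w = 0 := Int.eq_zero_of_abs_lt_dvd h0 (hbound w)
    intro i
    exact (pat_eq_zero_iff _ _ _).1 (hfree w hzero i)
  · intro hgood
    have hw0 : ∀ i, w i = 0 := fun i => (pat_eq_zero_iff _ _ _).2 (hgood i)
    have hzero : wordSum p q w = 0 := by
      unfold wordSum
      refine Finset.sum_eq_zero fun i _ => ?_
      rw [hw0 i, coeff_zero]
      simp
    rw [hcast, hT, hzero]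
    simp

end Summit.MatrixMultiplication.MatrixMultiplication.Theorems.HostingRateThree.RadixCarryHosting
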